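import Mathlib
import HarnessLib
import Summits.PneNP.PneNP.Theorems.CnfIdealGenLengthRankDefectRepresentationsWeightDecomposition

/-!
# Rank-stability of complete orthogonal idempotent families (line rank-dehn-ladder, NOL roadmap)

Crux `stmt-PneNP-18923` (`Summit.PneNP.PneNP.Theses.CnfIdealGenLength.RankDefectRepresentations`), line
`rank-dehn-ladder`, negative side (roadmap `Cruxes/RankDefectRepresentations/Lines/rank-dehn-ladder-NOL.md`): the
standard presentation of the algebra `K^{b+1}` — `r_l² = r_l`, `r_l r_m = 0 (l ≠ m)`, `∑ r_l = 1` — is UNIFORMLY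
RANK-STABLE with a polynomial constant: matrices satisfying the relations up to rank `s` are within rank `3(b+2)²s`
of an exact complete orthogonal family of idempotents (char 0).  This is the re-orthogonalisation step of the dyadic
weight-refinement scheme; the weight decomposition `…WeightDecomposition.stub_weightDecomposition` is the companion
step.  Proof: `D = ∑ l•r_l` satisfies `rank ((D − m) r_m) ≤ (b+1)s`, hence `N = ∏_l (D − l)` has rank
`≤ ((b+1)²+1)s`; the Lagrange idempotents `ℓ_m(D)` are within `(b+1)²s + s` of `r_m`; the exact family is
`Q_m = ℓ_m(D)π + [m = 0](1 − π)` with `π` the kernel projection of `N` (`…WeightDecomposition.core`, made explicit).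
HONEST FRAMING: elementary linear algebra; P ≠ NP is not moved; F-N2 is a FRONTIER formal rung.
-/

set_option linter.dupNamespace false -- `Summit.PneNP.PneNP.…`: summit = sub-problem name (D-0017)

namespace Summit.PneNP.PneNP.Theorems.CnfIdealGenLengthRankDefectRepresentationsOrthogonalFamilyStability

open Finset Polynomial
open Literature.Computability.AlgebraicComplexity (rank_sum_le rank_smul_le)
open Summit.PneNP.PneNP.Theorems.CnfIdealGenLengthRankDefectRepresentationsTseitinTransfer (rk_add rk_sub rk_neg)
open Summit.PneNP.PneNP.Theorems.CnfIdealGenLengthRankDefectRepresentationsWeightDecomposition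
  (exists_generalized_inverse aeval_mul_kerProj_eq_zero nodal_dvd_of_eval_eq_zero eval_basis_mul_basis_of_ne
    eval_basis_sq_sub_basis eval_sum_C_mul_basis_sub_X sum_basis_eq_one aeval_mul_comm rank_one_sub_kerProj
    kerProj_mul_mul_kerProj mul_kerProj_mul_one_sub one_sub_mul_mul_kerProj one_sub_kerProj_idem)

variable {K : Type} [Field K] {d b : ℕ}

/-- `…WeightDecomposition.core` with the witness made explicit: `Q_k = L_k π + [k = 0](1 − π)`. -/
theorem core_explicit (E N B : Matrix (Fin d) (Fin d) K) (L : Fin (b + 1) → Matrix (Fin d) (Fin d) K)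
    (hB : N * B * N = N) (hLN : ∀ k, L k * N = N * L k)
    (hLL : ∀ k l, k ≠ l → L k * L l * (1 - B * N) = 0)
    (hL2 : ∀ k, (L k * L k - L k) * (1 - B * N) = 0) (hLsum : ∑ k, L k = 1)
    (hLE : (∑ k : Fin (b + 1), ((k : ℕ) : K) • L k - E) * (1 - B * N) = 0) :
    ∃ Q : Fin (b + 1) → Matrix (Fin d) (Fin d) K,
      (∀ k, Q k * Q k = Q k) ∧ (∀ k l, k ≠ l → Q k * Q l = 0) ∧ (∑ k, Q k = 1) ∧
      (∑ k : Fin (b + 1), ((k : ℕ) : K) • Q k) = E * (1 - B * N) ∧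
      ∀ k, Q k = L k * (1 - B * N) + if k = 0 then 1 - (1 - B * N) else 0 := by
  have hprod : ∀ k l, (L k * (1 - B * N) + if k = 0 then 1 - (1 - B * N) else 0) *
      (L l * (1 - B * N) + if l = 0 then 1 - (1 - B * N) else 0) =
      L k * L l * (1 - B * N) + if k = 0 ∧ l = 0 then 1 - (1 - B * N) else 0 := by
    intro k l
    have h0 : L k * (1 - B * N) * (L l * (1 - B * N)) = L k * L l * (1 - B * N) := by
      rw [Matrix.mul_assoc, kerProj_mul_mul_kerProj N B (L l) hB (hLN l), ← Matrix.mul_assoc]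
    have h1 := mul_kerProj_mul_one_sub N B (L k) hB
    have h2 := one_sub_mul_mul_kerProj N B (L l) hB (hLN l)
    have h3 := one_sub_kerProj_idem N B hB
    simp only [add_mul, mul_add, ite_mul, mul_ite, zero_mul, mul_zero, h0, h1, h2, h3]
    by_cases hk : k = 0 <;> by_cases hl : l = 0 <;> simp [hk, hl]
  refine ⟨fun k => L k * (1 - B * N) + if k = 0 then 1 - (1 - B * N) else 0, ?_, ?_, ?_, ?_, fun k => rfl⟩
  · intro k
    simp only [hprod, and_self]
    congr 1
    have h := hL2 k
    rwa [sub_mul, sub_eq_zero] at h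
  · intro k l hkl
    simp only [hprod]
    rw [hLL k l hkl, if_neg (fun h => hkl (h.1.trans h.2.symm)), zero_add]
  · simp only [Finset.sum_add_distrib, Finset.sum_ite_eq', Finset.mem_univ, if_true]
    rw [← Finset.sum_mul, hLsum, one_mul, add_sub_cancel]
  · simp only [smul_add, smul_ite, smul_zero, Finset.sum_add_distrib, Finset.sum_ite_eq', Finset.mem_univ,
      if_true, Fin.val_zero, Nat.cast_zero, zero_smul, add_zero]
    have h : ∑ k : Fin (b + 1), ((k : ℕ) : K) • (L k * (1 - B * N)) =
        (∑ k : Fin (b + 1), ((k : ℕ) : K) • L k) * (1 - B * N) := by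
      rw [Finset.sum_mul]; simp only [smul_mul_assoc]
    rw [h]
    rwa [sub_mul, sub_eq_zero] at hLE

/-- `rank ((D − m) r_m) ≤ (b+1)s` for `D = ∑ l•r_l` and a near-orthogonal near-idempotent family. -/
theorem rank_weightedSum_sub_mul_le (r : Fin (b + 1) → Matrix (Fin d) (Fin d) K) (s : ℕ)
    (hidem : ∀ l, (r l * r l - r l).rank ≤ s) (horth : ∀ l m, l ≠ m → (r l * r m).rank ≤ s) (m : Fin (b + 1)) :
    ((∑ l : Fin (b + 1), ((l : ℕ) : K) • r l - ((m : ℕ) : K) • (1 : Matrix (Fin d) (Fin d) K)) * r m).rank ≤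
      (b + 1) * s := by
  have h : (∑ l : Fin (b + 1), ((l : ℕ) : K) • r l - ((m : ℕ) : K) • (1 : Matrix (Fin d) (Fin d) K)) * r m =
      ∑ l : Fin (b + 1), ((l : ℕ) : K) • (r l * r m - if l = m then r m else 0) := by
    simp only [sub_mul, Finset.sum_mul, smul_mul_assoc, one_mul, smul_sub, Finset.sum_sub_distrib, smul_ite,
      smul_zero, Finset.sum_ite_eq', Finset.mem_univ, if_true]
  rw [h]
  refine (rank_sum_le _ _).trans ?_
  calc ∑ l : Fin (b + 1), (((l : ℕ) : K) • (r l * r m - if l = m then r m else 0)).rank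
      ≤ ∑ _l : Fin (b + 1), s := by
        refine Finset.sum_le_sum fun l _ => (rank_smul_le _ _).trans ?_
        by_cases hl : l = m
        · subst hl; rw [if_pos rfl]; exact hidem l
        · rw [if_neg hl, sub_zero]; exact horth l m hl
    _ = (b + 1) * s := by simp

/-- If `q` has the root `m` then `q(D) r_m` is controlled by `(D − m) r_m`. -/
theorem rank_aeval_mul_le_of_isRoot (r : Fin (b + 1) → Matrix (Fin d) (Fin d) K) (s : ℕ)
    (hidem : ∀ l, (r l * r l - r l).rank ≤ s) (horth : ∀ l m, l ≠ m → (r l * r m).rank ≤ s) (m : Fin (b + 1))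
    (q : K[X]) (hq : (X - C ((m : ℕ) : K)) ∣ q) :
    (aeval (∑ l : Fin (b + 1), ((l : ℕ) : K) • r l) q * r m).rank ≤ (b + 1) * s := by
  obtain ⟨q', hq'⟩ := hq
  rw [hq', mul_comm, map_mul, map_sub, aeval_X, aeval_C, Algebra.algebraMap_eq_smul_one, Matrix.mul_assoc]
  exact (Matrix.rank_mul_le_right _ _).trans (rank_weightedSum_sub_mul_le r s hidem horth m)

/-- `rank ∏_l (D − l) ≤ ((b+1)² + 1)s`. -/
theorem rank_nodal_le (r : Fin (b + 1) → Matrix (Fin d) (Fin d) K) (s : ℕ)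
    (hidem : ∀ l, (r l * r l - r l).rank ≤ s) (horth : ∀ l m, l ≠ m → (r l * r m).rank ≤ s)
    (hone : (∑ l, r l - 1).rank ≤ s) :
    (aeval (∑ l : Fin (b + 1), ((l : ℕ) : K) • r l) (∏ l : Fin (b + 1), (X - C ((l : ℕ) : K)))).rank ≤
      (b + 1) * ((b + 1) * s) + s := by
  set N := aeval (∑ l : Fin (b + 1), ((l : ℕ) : K) • r l) (∏ l : Fin (b + 1), (X - C ((l : ℕ) : K))) with hN
  have hsplit : N = ∑ m, N * r m + N * (1 - ∑ m, r m) := by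
    rw [← Finset.mul_sum, ← mul_add, add_sub_cancel, mul_one]
  rw [hsplit]
  refine (rk_add _ _).trans (Nat.add_le_add ?_ ?_)
  · refine (rank_sum_le _ _).trans ?_
    calc ∑ m : Fin (b + 1), (N * r m).rank ≤ ∑ _m : Fin (b + 1), (b + 1) * s :=
          Finset.sum_le_sum fun m _ => rank_aeval_mul_le_of_isRoot r s hidem horth m _
            (Finset.dvd_prod_of_mem (fun l : Fin (b + 1) => X - C ((l : ℕ) : K)) (mem_univ m))
      _ = (b + 1) * ((b + 1) * s) := by simp
  · have h : (1 : Matrix (Fin d) (Fin d) K) - ∑ m, r m = -(∑ m, r m - 1) := by abel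
    rw [h]
    calc (N * -(∑ m, r m - 1)).rank ≤ (-(∑ m, r m - 1)).rank := Matrix.rank_mul_le_right _ _
      _ = (∑ m, r m - 1).rank := rk_neg _
      _ ≤ s := hone

/-- The Lagrange idempotent `ℓ_m(D)` is within rank `(b+1)²s + s` of `r_m`. -/
theorem rank_lagrange_sub_le [CharZero K] (r : Fin (b + 1) → Matrix (Fin d) (Fin d) K) (s : ℕ)
    (hidem : ∀ l, (r l * r l - r l).rank ≤ s) (horth : ∀ l m, l ≠ m → (r l * r m).rank ≤ s)
    (hone : (∑ l, r l - 1).rank ≤ s) (m : Fin (b + 1)) :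
    (aeval (∑ l : Fin (b + 1), ((l : ℕ) : K) • r l)
        (Lagrange.basis univ (fun k : Fin (b + 1) => ((k : ℕ) : K)) m) - r m).rank ≤
      (b + 1) * ((b + 1) * s) + s := by
  have hv : Function.Injective (fun k : Fin (b + 1) => ((k : ℕ) : K)) := fun a c h =>
    Fin.ext (Nat.cast_injective (R := K) h)
  set D := ∑ l : Fin (b + 1), ((l : ℕ) : K) • r l with hD
  set ℓ := Lagrange.basis univ (fun k : Fin (b + 1) => ((k : ℕ) : K)) m with hℓ
  have hδ : ∑ k : Fin (b + 1), (eval ((k : ℕ) : K) ℓ) • r k = r m := by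
    rw [Finset.sum_eq_single m]
    · rw [hℓ, Lagrange.eval_basis_self (v := fun k : Fin (b + 1) => ((k : ℕ) : K)) hv.injOn (mem_univ m),
        one_smul]
    · intro k _ hkm
      rw [hℓ, Lagrange.eval_basis_of_ne (v := fun k : Fin (b + 1) => ((k : ℕ) : K)) (Ne.symm hkm) (mem_univ k),
        zero_smul]
    · intro h; exact absurd (mem_univ m) h
  have hsplit : aeval D ℓ - r m =
      ∑ k : Fin (b + 1), (aeval D ℓ * r k - (eval ((k : ℕ) : K) ℓ) • r k) + aeval D ℓ * (1 - ∑ k, r k) := by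
    have h : aeval D ℓ - r m = (aeval D ℓ * ∑ k, r k - ∑ k : Fin (b + 1), (eval ((k : ℕ) : K) ℓ) • r k) +
        aeval D ℓ * (1 - ∑ k, r k) := by
      rw [hδ, mul_sub, mul_one]; abel
    rw [h, Finset.mul_sum, ← Finset.sum_sub_distrib]
  rw [hsplit]
  refine (rk_add _ _).trans (Nat.add_le_add ?_ ?_)
  · refine (rank_sum_le _ _).trans ?_
    calc ∑ k : Fin (b + 1), (aeval D ℓ * r k - (eval ((k : ℕ) : K) ℓ) • r k).rank
        ≤ ∑ _k : Fin (b + 1), (b + 1) * s := by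
          refine Finset.sum_le_sum fun k _ => ?_
          have h : aeval D ℓ * r k - (eval ((k : ℕ) : K) ℓ) • r k = aeval D (ℓ - C (eval ((k : ℕ) : K) ℓ)) * r k := by
            rw [map_sub, aeval_C, Algebra.algebraMap_eq_smul_one, sub_mul, smul_one_mul]
          rw [h]
          exact rank_aeval_mul_le_of_isRoot r s hidem horth k _ X_sub_C_dvd_sub_C_eval
      _ = (b + 1) * ((b + 1) * s) := by simp
  · have h : (1 : Matrix (Fin d) (Fin d) K) - ∑ k, r k = -(∑ k, r k - 1) := by abel
    rw [h]
    calc (aeval D ℓ * -(∑ k, r k - 1)).rank ≤ (-(∑ k, r k - 1)).rank := Matrix.rank_mul_le_right _ _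
      _ = (∑ k, r k - 1).rank := rk_neg _
      _ ≤ s := hone

/-- UNIFORM RANK-STABILITY OF `K^{b+1}`: a family of `b + 1` matrices over a field of characteristic zero that is
idempotent, orthogonal and complete up to rank `s` is within rank `3(b+2)²s` (entrywise in the family) of an exact
complete orthogonal family of idempotents. -/
theorem orthogonalFamily_stable [CharZero K] (r : Fin (b + 1) → Matrix (Fin d) (Fin d) K) (s : ℕ)
    (hidem : ∀ l, (r l * r l - r l).rank ≤ s) (horth : ∀ l m, l ≠ m → (r l * r m).rank ≤ s)
    (hone : (∑ l, r l - 1).rank ≤ s) :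
    ∃ Q : Fin (b + 1) → Matrix (Fin d) (Fin d) K,
      (∀ l, Q l * Q l = Q l) ∧ (∀ l m, l ≠ m → Q l * Q m = 0) ∧ (∑ l, Q l = 1) ∧
      ∀ m, (Q m - r m).rank ≤ 3 * (b + 2) ^ 2 * s := by
  have hv : Function.Injective (fun k : Fin (b + 1) => ((k : ℕ) : K)) := fun a c h =>
    Fin.ext (Nat.cast_injective (R := K) h)
  have hNrank := rank_nodal_le r s hidem horth hone
  have hLr := rank_lagrange_sub_le r s hidem horth hone
  obtain ⟨B, hB⟩ := exists_generalized_inverse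
    (aeval (∑ l : Fin (b + 1), ((l : ℕ) : K) • r l) (∏ l : Fin (b + 1), (X - C ((l : ℕ) : K))))
  set D : Matrix (Fin d) (Fin d) K := ∑ l : Fin (b + 1), ((l : ℕ) : K) • r l with hD
  set P : K[X] := ∏ l : Fin (b + 1), (X - C ((l : ℕ) : K)) with hP
  set N : Matrix (Fin d) (Fin d) K := aeval D P with hN
  have hvan : ∀ q : K[X], (∀ j : Fin (b + 1), eval ((fun k : Fin (b + 1) => ((k : ℕ) : K)) j) q = 0) →
      aeval D q * (1 - B * N) = 0 :=
    fun q hq => aeval_mul_kerProj_eq_zero D B P q hB (nodal_dvd_of_eval_eq_zero hv q hq)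
  have hLN : ∀ k : Fin (b + 1),
      aeval D (Lagrange.basis univ (fun k : Fin (b + 1) => ((k : ℕ) : K)) k) * N =
        N * aeval D (Lagrange.basis univ (fun k : Fin (b + 1) => ((k : ℕ) : K)) k) :=
    fun k => aeval_mul_comm D _ _
  have hLL : ∀ k l : Fin (b + 1), k ≠ l →
      aeval D (Lagrange.basis univ (fun k : Fin (b + 1) => ((k : ℕ) : K)) k) *
        aeval D (Lagrange.basis univ (fun k : Fin (b + 1) => ((k : ℕ) : K)) l) * (1 - B * N) = 0 := by
    intro k l hkl
    have h := hvan _ (eval_basis_mul_basis_of_ne hkl)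
    rwa [map_mul] at h
  have hL2 : ∀ k : Fin (b + 1),
      (aeval D (Lagrange.basis univ (fun k : Fin (b + 1) => ((k : ℕ) : K)) k) *
        aeval D (Lagrange.basis univ (fun k : Fin (b + 1) => ((k : ℕ) : K)) k) -
        aeval D (Lagrange.basis univ (fun k : Fin (b + 1) => ((k : ℕ) : K)) k)) * (1 - B * N) = 0 := by
    intro k
    have h := hvan _ (eval_basis_sq_sub_basis hv k)
    rwa [map_sub, map_mul] at h
  have hLsum : ∑ k, aeval D (Lagrange.basis univ (fun k : Fin (b + 1) => ((k : ℕ) : K)) k) = 1 := by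
    rw [← map_sum, sum_basis_eq_one hv, map_one]
  have hLE : (∑ k : Fin (b + 1), ((k : ℕ) : K) •
      aeval D (Lagrange.basis univ (fun k : Fin (b + 1) => ((k : ℕ) : K)) k) - D) * (1 - B * N) = 0 := by
    have h := hvan _ (eval_sum_C_mul_basis_sub_X hv)
    simpa only [map_sub, aeval_X, map_sum, map_mul, aeval_C, Algebra.algebraMap_eq_smul_one, smul_one_mul]
      using h
  obtain ⟨Q, hQidem, hQorth, hQsum, -, hQdef⟩ := core_explicit D N B _ hB hLN hLL hL2 hLsum hLE
  refine ⟨Q, hQidem, hQorth, hQsum, fun m => ?_⟩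
  have hπ : (1 - (1 - B * N)).rank ≤ (b + 1) * ((b + 1) * s) + s := (rank_one_sub_kerProj N B).trans hNrank
  have e : Q m - r m =
      (aeval D (Lagrange.basis univ (fun k : Fin (b + 1) => ((k : ℕ) : K)) m) - r m) * (1 - B * N) -
        r m * (1 - (1 - B * N)) + (if m = 0 then 1 - (1 - B * N) else 0) := by
    rw [hQdef m]; noncomm_ring
  rw [e]
  have hite : (if m = 0 then (1 : Matrix (Fin d) (Fin d) K) - (1 - B * N) else 0).rank ≤
      (b + 1) * ((b + 1) * s) + s := by
    split_ifs
    · exact hπ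
    · rw [Matrix.rank_zero]; exact Nat.zero_le _
  refine (rk_add _ _).trans ?_
  refine (Nat.add_le_add ((rk_sub _ _).trans (Nat.add_le_add
    ((Matrix.rank_mul_le_left _ _).trans (hLr m)) ((Matrix.rank_mul_le_right _ _).trans hπ))) hite).trans ?_
  have h1 : (b + 1) * ((b + 1) * s) + s ≤ (b + 2) ^ 2 * s := by nlinarith
  nlinarith

end Summit.PneNP.PneNP.Theorems.CnfIdealGenLengthRankDefectRepresentationsOrthogonalFamilyStability
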